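import Summits.NavierStokesRegularity.NavierStokesRegularity.Theorems.StableStrataDoorOneSliceSeqDoor

/-!
# OneTimeDoorSchema — «ONE TIME» vs «ALONG A SEQUENCE OF TIMES» for the S26 door family (nsreg-p1 g23 SEED-28-A,
# `r27/OneTimeSchema.lean` v2 5300b96bcafb33bf; theorems-only landing by nsreg-p6 g15, DIRECTOR-NS #100)

«ONE TIME» versus «ALONG A SEQUENCE OF TIMES» for the S26 door family (`StableStrataDoorOneSliceSeqDoor.SeqDoorAt Φ ν M`).

* §1 texts: `OneTimeDoorAt Φ ν M` — the one-time door whose lateness threshold `t⋆ < T` may depend on the SOLUTION;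
  `UniformOneTimeDoorAt Φ ν M` — the one-time door whose lateness threshold depends only on the CLASS `(T, ρ, E₀)`
  (life span, Type-I radius, initial kinetic energy) — the Pineau–Vicol shape (`s₀ = s₀(C_u, C_p)`, arXiv:2607.09619 Thm 1.9);
  `LocalPointZoomAcrossSolutionsM` — I1⋆, the one typed input: I1 (`LocalPointZoomAlongTimesM`) with the solution, the pressure
  and the centre allowed to vary along the sequence inside the fixed class.
* §2 PROVED (pure logic): `oneTimeDoorAt_iff_seqDoorAt` — with solution-dependent lateness «one time» is EXACTLY the sequential
  door (so a one-time criterion has teeth beyond `SeqDoorAt` only through a lateness threshold uniform in a named class).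
* §3 PROVED: `oneTimeDoorAt_of_uniform` — the class-uniform door implies the solution-dependent one (hence `SeqDoorAt`, hence
  S26's eventual door).
* §4 PROVED: `hasTypeIDecay_of_zoomSeq`, `windowLimit_atSeq` — the two zoom lemmas of the tree with varying solution / centre.
* §5 PROVED modulo I1⋆: `uniformOneTimeDoorAt_of` (I1⋆ + (H1) + one-slice residue) and `uniformOneTimeDoorAt_of_liouville`
  (I1⋆ + (H1) + (H2) + one-slice stratum Liouville) — i.e. EVERY S26 door (quiet, axisymmetric, sine-moment S27, …) upgrades to
  the class-uniform ONE-TIME form the moment I1⋆ is landed; `ε = ε(ν, M, Φ)` is the SAME compactness constant as in `SeqDoorAt`.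

WHAT THIS IS NOT: not NS regularity, not a dent in `NoTypeII` (stmt-0056); a quantifier upgrade INSIDE the Type-I class,
conditional on I1⋆; neither `ε` nor `t⋆` is explicit (compactness).
-/

noncomputable section

set_option linter.dupNamespace false

namespace Summit.NavierStokesRegularity.NavierStokesRegularity.Theorems.OneTimeDoorSchema

open MeasureTheory Set Function Filter Topology TopologicalSpace Metric
open scoped RealInnerProductSpace NNReal ENNReal Topology
open Literature.Analysis Literature.Analysis.FluidPDE
open Summit.NavierStokesRegularity.NavierStokesRegularity.Theorems.PoloidalWindowDoorPoloidalWindowRigidityWindow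
open Summit.NavierStokesRegularity.NavierStokesRegularity.Theorems.ZoomReturnDoorDefs
open Summit.NavierStokesRegularity.NavierStokesRegularity.Theorems.StableStrataDoorDefs
open Summit.NavierStokesRegularity.NavierStokesRegularity.Theorems.StableStrataDoorWindowLimit
open Summit.NavierStokesRegularity.NavierStokesRegularity.Theorems.StableStrataDoorSchema
open Summit.NavierStokesRegularity.NavierStokesRegularity.Theorems.StableStrataDoorOneSliceDefs
open Summit.NavierStokesRegularity.NavierStokesRegularity.Theorems.StableStrataDoorFloorSurvives
open Summit.NavierStokesRegularity.NavierStokesRegularity.Theorems.StableStrataDoorOneSliceSeqDoor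

variable (Φ : (EuclideanSpace ℝ (Fin 3) → EuclideanSpace ℝ (Fin 3)) → ℝ≥0∞)
  (𝔖 : Set (EuclideanSpace ℝ (Fin 3) → EuclideanSpace ℝ (Fin 3)))

/-! ## §1 Texts -/

/-- **the ONE-TIME ε-door with solution-dependent lateness** at constants `(ν, M)`: some `ε > 0` such that for every
solution of the door frame and every candidate point under local Type I(`M`) there is a lateness threshold `t⋆ < T`
(allowed to depend on everything, the solution included) after which `Φ ≤ ε` at ONE time excludes the singularity. -/
def OneTimeDoorAt (ν M : ℝ) : Prop :=
  ∃ ε : ℝ, 0 < ε ∧ ∀ (T : ℝ), 0 < T →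
    ∀ (u : ℝ → EuclideanSpace ℝ (Fin 3) → EuclideanSpace ℝ (Fin 3)) (p : ℝ → EuclideanSpace ℝ (Fin 3) → ℝ),
    IsClassicalNSSolutionOn (Set.Ico 0 T) ν 0 u p → IsLerayHopfOn T ν 0 (u 0) u → HasRapidSpatialDecay (u 0) →
    ∀ (x₀ : EuclideanSpace ℝ (Fin 3)) (ρ : ℝ), 0 < ρ →
    (∀ t ∈ Set.Ico 0 T, T - ρ ^ 2 < t → ∀ x ∈ Metric.ball x₀ ρ, ‖u t x‖ * (‖x - x₀‖ + Real.sqrt (ν * (T - t))) ≤ M) →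
    ∃ tstar : ℝ, tstar < T ∧ ∀ tb ∈ Set.Ioo tstar T,
      Φ (physWindowField T x₀ u tb) ≤ ENNReal.ofReal ε → IsBackwardBoundedAt u T x₀

/-- **the CLASS-UNIFORM ONE-TIME ε-door** at constants `(ν, M)`: some `ε > 0` such that for every class `(T, ρ, E₀)` there is
ONE lateness threshold `t⋆ = t⋆(ν, M, T, ρ, E₀) < T` serving every solution of the door frame with life span `T`, initial kinetic
energy `≤ E₀` and local Type I(`M`) on `Q_ρ(x₀, T)`: `Φ ≤ ε` at ONE time `t̄ ∈ (t⋆, T)` excludes the singularity at `(x₀, T)`. -/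
def UniformOneTimeDoorAt (ν M : ℝ) : Prop :=
  ∃ ε : ℝ, 0 < ε ∧ ∀ (T ρ E₀ : ℝ), 0 < T → 0 < ρ → ∃ tstar : ℝ, tstar < T ∧
    ∀ (u : ℝ → EuclideanSpace ℝ (Fin 3) → EuclideanSpace ℝ (Fin 3)) (p : ℝ → EuclideanSpace ℝ (Fin 3) → ℝ),
    IsClassicalNSSolutionOn (Set.Ico 0 T) ν 0 u p → IsLerayHopfOn T ν 0 (u 0) u → HasRapidSpatialDecay (u 0) →
    VectorCalculus.kineticEnergy (u 0) ≤ E₀ →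
    ∀ (x₀ : EuclideanSpace ℝ (Fin 3)),
    (∀ t ∈ Set.Ico 0 T, T - ρ ^ 2 < t → ∀ x ∈ Metric.ball x₀ ρ, ‖u t x‖ * (‖x - x₀‖ + Real.sqrt (ν * (T - t))) ≤ M) →
    ∀ tb ∈ Set.Ioo tstar T, Φ (physWindowField T x₀ u tb) ≤ ENNReal.ofReal ε → IsBackwardBoundedAt u T x₀

/-- **I1⋆ · THE LOCAL POINT ZOOM ACROSS SOLUTIONS OF ONE CLASS** (floor constant `c = c(ν, M)`): as I1
(`LocalPointZoomAlongTimesM`), but along the sequence the SOLUTION `uₙ`, its pressure `pₙ` and the centre `xₙ` may vary inside the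
fixed class — life span `T`, Type-I radius `ρ`, initial kinetic energy `≤ E₀`, local Type I(`M`) at `(xₙ, T)`, backward-unbounded at
`(xₙ, T)` — while the zoom times `tₙ → T⁻` are prescribed: along a subsequence the parabolic zooms of `uₙ` about `(xₙ, T)` at the
scales `λₙ² = ν (T − tₙ)` converge pointwise at every profile time to ONE door-class profile carrying the `L³`-floor `c` at the apex.
(Same analysis as I1: the inputs of the local compactness near `(xₙ, T)` — Type-I bound, far-field pressure `≲ E₀ ρ⁻³`, life span —
are exactly the class constants; persistence of the singularity along prescribed scales uses only the scale-invariant Type-I bound.)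
v2 (2026-08-28T02:2xZ, nsreg-p6 g15 shape question): the Type-I decay `HasTypeIDecay (M/ν) v` of the limit is a CONCLUSION
(p6 exports it from the zoom engine), and pointwise convergence is required only for profile times `s < −1/4` (the consumer
uses the slice `s = −1`); the all-`s<0` diagonal is not needed. -/
def LocalPointZoomAcrossSolutionsM : Prop :=
  ∀ (ν : ℝ), 0 < ν → ∀ (M : ℝ), ∃ c : ℝ, 0 < c ∧ ∀ (T ρ E₀ : ℝ), 0 < T → 0 < ρ →
    ∀ (u : ℕ → ℝ → EuclideanSpace ℝ (Fin 3) → EuclideanSpace ℝ (Fin 3)) (p : ℕ → ℝ → EuclideanSpace ℝ (Fin 3) → ℝ)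
      (x : ℕ → EuclideanSpace ℝ (Fin 3)) (t : ℕ → ℝ),
    (∀ n, IsClassicalNSSolutionOn (Set.Ico 0 T) ν 0 (u n) (p n)) → (∀ n, IsLerayHopfOn T ν 0 (u n 0) (u n)) →
    (∀ n, HasRapidSpatialDecay (u n 0)) → (∀ n, VectorCalculus.kineticEnergy (u n 0) ≤ E₀) →
    (∀ n, ∀ s ∈ Set.Ico 0 T, T - ρ ^ 2 < s → ∀ z ∈ Metric.ball (x n) ρ,
      ‖u n s z‖ * (‖z - x n‖ + Real.sqrt (ν * (T - s))) ≤ M) →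
    (∀ n, ¬ IsBackwardBoundedAt (u n) T (x n)) →
    (∀ n, t n < T) → Tendsto t atTop (𝓝 T) →
    ∃ (φ : ℕ → ℕ) (C : ℝ) (v : ℝ → EuclideanSpace ℝ (Fin 3) → EuclideanSpace ℝ (Fin 3)) (lam : ℕ → ℝ),
      StrictMono φ ∧ (∀ j, 0 < lam j) ∧ (∀ j, lam j ^ 2 = ν * (T - t (φ j))) ∧ IsDoorProfile C v ∧
      HasTypeIDecay (M / ν) v ∧ HasL3Floor c v ∧
      ∀ s < -(1 / 4 : ℝ), ∀ y,
        Tendsto (fun j => (lam j / ν) • u (φ j) (T + lam j ^ 2 * s / ν) (x (φ j) + lam j • y)) atTop (𝓝 (v s y))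

variable {Φ 𝔖}

/-! ## §2 «one time with solution-dependent lateness» ⟺ «along a sequence of times» (pure logic) -/

/-- the canonical lateness sequence `T − 1/(n+1) → T`. -/
theorem tendsto_sub_inv_succ (T : ℝ) : Tendsto (fun n : ℕ => T - 1 / ((n : ℝ) + 1)) atTop (𝓝 T) := by
  have h : Tendsto (fun n : ℕ => 1 / ((n : ℝ) + 1)) atTop (𝓝 0) := tendsto_one_div_add_atTop_nhds_zero_nat
  simpa using tendsto_const_nhds.sub h

/-- the canonical lateness thresholds lie below `T`. -/
theorem sub_inv_succ_lt (T : ℝ) (n : ℕ) : T - 1 / ((n : ℝ) + 1) < T := by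
  have : (0 : ℝ) < 1 / ((n : ℝ) + 1) := by positivity
  linarith

/-- **PROVED: the one-time door with solution-dependent lateness is EQUIVALENT to the sequential door.** -/
theorem oneTimeDoorAt_iff_seqDoorAt {ν M : ℝ} : OneTimeDoorAt Φ ν M ↔ SeqDoorAt Φ ν M := by
  constructor
  · rintro ⟨ε, hε, h⟩
    refine ⟨ε, hε, fun T hT u p hcl hLH hdec x₀ ρ hρ hM t htT ht hgood => ?_⟩
    obtain ⟨tstar, htstar, hts⟩ := h T hT u p hcl hLH hdec x₀ ρ hρ hM
    obtain ⟨n, hn⟩ := (ht.eventually (lt_mem_nhds htstar)).exists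
    exact hts (t n) ⟨hn, htT n⟩ (hgood n)
  · rintro ⟨ε, hε, h⟩
    refine ⟨ε, hε, fun T hT u p hcl hLH hdec x₀ ρ hρ hM => ?_⟩
    by_contra hno
    push Not at hno
    have hsel : ∀ n : ℕ, ∃ tb ∈ Set.Ioo (T - 1 / ((n : ℝ) + 1)) T,
        Φ (physWindowField T x₀ u tb) ≤ ENNReal.ofReal ε ∧ ¬ IsBackwardBoundedAt u T x₀ := fun n =>
      hno _ (sub_inv_succ_lt T n)
    choose tb htb hΦ hnb using hsel
    have hlim : Tendsto tb atTop (𝓝 T) :=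
      tendsto_of_tendsto_of_tendsto_of_le_of_le (tendsto_sub_inv_succ T) tendsto_const_nhds
        (fun n => (htb n).1.le) (fun n => (htb n).2.le)
    exact hnb 0 (h T hT u p hcl hLH hdec x₀ ρ hρ hM tb (fun n => (htb n).2) hlim hΦ)

/-! ## §3 the class-uniform door implies the solution-dependent one -/

/-- **PROVED:** `UniformOneTimeDoorAt Φ ν M → OneTimeDoorAt Φ ν M` (take `E₀ =` the solution's own initial energy). -/
theorem oneTimeDoorAt_of_uniform {ν M : ℝ} (h : UniformOneTimeDoorAt Φ ν M) : OneTimeDoorAt Φ ν M := by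
  obtain ⟨ε, hε, h⟩ := h
  refine ⟨ε, hε, fun T hT u p hcl hLH hdec x₀ ρ hρ hM => ?_⟩
  obtain ⟨tstar, htstar, hts⟩ := h T ρ (VectorCalculus.kineticEnergy (u 0)) hT hρ
  exact ⟨tstar, htstar, fun tb htb hΦ => hts u p hcl hLH hdec le_rfl x₀ hM tb htb hΦ⟩

/-- corollary: the class-uniform door implies the sequential door (and hence S26's eventual door). -/
theorem seqDoorAt_of_uniform {ν M : ℝ} (h : UniformOneTimeDoorAt Φ ν M) : SeqDoorAt Φ ν M :=
  oneTimeDoorAt_iff_seqDoorAt.1 (oneTimeDoorAt_of_uniform h)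

/-! ## §4 the two zoom lemmas of the tree with varying solution / centre -/

/-- Type-I decay of the zoom limit, solutions and centres varying along the sequence
(`PlaneStrainDoorZoomSpaceTimeDecay.hasTypeIDecay_of_zoom` verbatim with indices). -/
theorem hasTypeIDecay_of_zoomSeq {ν T ρ M : ℝ} (hν : 0 < ν) (hT : 0 < T) (hρ : 0 < ρ)
    {u : ℕ → ℝ → EuclideanSpace ℝ (Fin 3) → EuclideanSpace ℝ (Fin 3)} {x : ℕ → EuclideanSpace ℝ (Fin 3)}
    {v : ℝ → EuclideanSpace ℝ (Fin 3) → EuclideanSpace ℝ (Fin 3)} {lam : ℕ → ℝ}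
    (hlam : ∀ j, 0 < lam j) (hlam0 : Tendsto lam atTop (𝓝 0))
    (hM : ∀ j, ∀ t ∈ Set.Ico 0 T, T - ρ ^ 2 < t → ∀ z ∈ Metric.ball (x j) ρ,
      ‖u j t z‖ * (‖z - x j‖ + Real.sqrt (ν * (T - t))) ≤ M)
    (hconv : ∀ s < 0, ∀ y,
      Tendsto (fun j => (lam j / ν) • u j (T + lam j ^ 2 * s / ν) (x j + lam j • y)) atTop (𝓝 (v s y))) :
    HasTypeIDecay (M / ν) v := by
  intro s hs y
  have hns : 0 < -s := neg_pos.2 hs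
  have hden : 0 < ‖y‖ + Real.sqrt (-s) := add_pos_of_nonneg_of_pos (norm_nonneg _) (Real.sqrt_pos.2 hns)
  set t : ℕ → ℝ := fun j => T + lam j ^ 2 * s / ν with ht
  have hTt : ∀ j, T - t j = lam j ^ 2 * (-s) / ν := fun j => by simp only [ht]; ring
  have htlt : ∀ j, t j < T := fun j => by
    have : 0 < lam j ^ 2 * (-s) / ν := div_pos (mul_pos (pow_pos (hlam j) 2) hns) hν
    linarith [hTt j]
  have htT : Tendsto t atTop (𝓝 T) := by
    have h1 : Tendsto (fun j => T + lam j ^ 2 * s / ν) atTop (𝓝 (T + 0 ^ 2 * s / ν)) :=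
      tendsto_const_nhds.add (((hlam0.pow 2).mul_const s).div_const ν)
    simpa using h1
  have hnorm : Tendsto (fun j => ‖lam j • y‖) atTop (𝓝 0) := by
    have h1 : Tendsto (fun j => lam j • y) atTop (𝓝 ((0 : ℝ) • y)) := hlam0.smul_const y
    rw [zero_smul] at h1
    simpa using h1.norm
  have hev1 : ∀ᶠ j in atTop, 0 < t j := htT.eventually (lt_mem_nhds hT)
  have hev2 : ∀ᶠ j in atTop, T - ρ ^ 2 < t j :=
    htT.eventually (lt_mem_nhds (by nlinarith [pow_pos hρ 2] : T - ρ ^ 2 < T))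
  have hev3 : ∀ᶠ j in atTop, ‖lam j • y‖ < ρ := hnorm.eventually (gt_mem_nhds hρ)
  have hbound : ∀ᶠ j in atTop,
      ‖(lam j / ν) • u j (T + lam j ^ 2 * s / ν) (x j + lam j • y)‖ ≤ M / ν / (‖y‖ + Real.sqrt (-s)) := by
    filter_upwards [hev1, hev2, hev3] with j h1 h2 h3
    have hmem : t j ∈ Set.Ico 0 T := ⟨h1.le, htlt j⟩
    have hball : x j + lam j • y ∈ Metric.ball (x j) ρ := by
      rw [Metric.mem_ball, dist_eq_norm, add_sub_cancel_left]; exact h3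
    have hMj := hM j (t j) hmem h2 (x j + lam j • y) hball
    have hdist : ‖x j + lam j • y - x j‖ = lam j * ‖y‖ := by
      rw [add_sub_cancel_left, norm_smul, Real.norm_eq_abs, abs_of_pos (hlam j)]
    have hsqrt : Real.sqrt (ν * (T - t j)) = lam j * Real.sqrt (-s) := by
      rw [hTt j, show ν * (lam j ^ 2 * (-s) / ν) = lam j ^ 2 * (-s) by field_simp,
        Real.sqrt_mul (pow_nonneg (hlam j).le 2), Real.sqrt_sq (hlam j).le]
    rw [hdist, hsqrt, ← mul_add] at hMj
    have hD : 0 < lam j * (‖y‖ + Real.sqrt (-s)) := mul_pos (hlam j) hden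
    have hu : ‖u j (t j) (x j + lam j • y)‖ ≤ M / (lam j * (‖y‖ + Real.sqrt (-s))) := (le_div_iff₀ hD).2 hMj
    have hcoef : 0 ≤ lam j / ν := (div_pos (hlam j) hν).le
    calc ‖(lam j / ν) • u j (T + lam j ^ 2 * s / ν) (x j + lam j • y)‖
        = (lam j / ν) * ‖u j (t j) (x j + lam j • y)‖ := by
          rw [norm_smul, Real.norm_eq_abs, abs_of_nonneg hcoef]
      _ ≤ (lam j / ν) * (M / (lam j * (‖y‖ + Real.sqrt (-s)))) := mul_le_mul_of_nonneg_left hu hcoef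
      _ = M / ν / (‖y‖ + Real.sqrt (-s)) := by
          have hlj : lam j ≠ 0 := (hlam j).ne'
          field_simp
  exact le_of_tendsto (hconv s hs y).norm hbound

/-- **WINDOW LIMIT AT ONE PROFILE TIME, solutions and centres varying** (`windowLimit_at` verbatim with indices): smallness of a
zoom-closed `Φ` on the physical window fields of `u_j` about `(x_j, T)` at the times `T + λ_j² s/ν` passes to the profile window
field of the limit at profile time `s`. -/
theorem windowLimit_atSeq (hlsc : IsWindowLsc Φ) {ν T : ℝ}
    {u : ℕ → ℝ → EuclideanSpace ℝ (Fin 3) → EuclideanSpace ℝ (Fin 3)} {p : ℕ → ℝ → EuclideanSpace ℝ (Fin 3) → ℝ}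
    {x : ℕ → EuclideanSpace ℝ (Fin 3)} {v : ℝ → EuclideanSpace ℝ (Fin 3) → EuclideanSpace ℝ (Fin 3)} {lam : ℕ → ℝ}
    (hν : 0 < ν) (hT : 0 < T) (hcl : ∀ j, IsClassicalNSSolutionOn (Ico 0 T) ν 0 (u j) (p j))
    (hlam : ∀ j, 0 < lam j) (hlam0 : Tendsto lam atTop (𝓝 0))
    {s : ℝ} (hconv : ∀ y,
      Tendsto (fun j => (lam j / ν) • u j (T + lam j ^ 2 * s / ν) (x j + lam j • y)) atTop (𝓝 (v s y)))
    {ε : ℝ} (hs : s < 0) (hvs : Continuous (v s))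
    (hsmall : ∀ᶠ j in atTop, Φ (physWindowField T (x j) (u j) (T + lam j ^ 2 * s / ν)) ≤ ENNReal.ofReal ε) :
    Φ (profileWindowField ν v s) ≤ ENNReal.ofReal ε := by
  have hns : 0 < -s := neg_pos.2 hs
  obtain ⟨t, ht⟩ : ∃ t : ℕ → ℝ, ∀ j, t j = T + lam j ^ 2 * s / ν := ⟨_, fun j => rfl⟩
  have hTt : ∀ j, T - t j = lam j ^ 2 * (-s) / ν := fun j => by rw [ht j]; ring
  have hc : ∀ j, 0 < lam j ^ 2 * (-s) / ν := fun j => div_pos (mul_pos (pow_pos (hlam j) 2) hns) hν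
  have hc0 : Tendsto (fun j => lam j ^ 2 * (-s) / ν) atTop (𝓝 0) := by
    simpa using ((hlam0.pow 2).mul_const (-s)).div_const ν
  have htT : Tendsto t atTop (𝓝[<] T) := by
    refine tendsto_nhdsWithin_iff.2 ⟨?_, Eventually.of_forall fun j => ?_⟩
    · have h1 : Tendsto (fun j => T - lam j ^ 2 * (-s) / ν) atTop (𝓝 (T - 0)) := tendsto_const_nhds.sub hc0
      rw [sub_zero] at h1
      refine h1.congr fun j => ?_
      rw [ht j]; ring
    · show t j < T
      have h1 := hc j
      rw [← hTt j] at h1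
      linarith
  have hev : ∀ᶠ j in atTop, t j ∈ Set.Ioo 0 T := htT.eventually (Ioo_mem_nhdsLT hT)
  obtain ⟨j₀, hj₀⟩ := eventually_atTop.1 hev
  have hshift : Tendsto (fun j : ℕ => j + j₀) atTop atTop := tendsto_add_atTop_nat j₀
  have hsmall' : ∀ᶠ j in atTop, Φ (physWindowField T (x j) (u j) (t j)) ≤ ENNReal.ofReal ε :=
    hsmall.mono fun j hj => by rw [ht j]; exact hj
  have hsmallj : ∀ᶠ j in atTop, Φ (physWindowField T (x (j + j₀)) (u (j + j₀)) (t (j + j₀))) ≤ ENNReal.ofReal ε :=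
    hshift.eventually hsmall'
  set σ : ℝ := Real.sqrt (-s) / Real.sqrt ν with hσ
  have hsq : ∀ j, Real.sqrt (T - t j) = lam j * σ := by
    intro j
    rw [hTt j, hσ, Real.sqrt_div' _ hν.le, Real.sqrt_mul (pow_nonneg (hlam j).le 2), Real.sqrt_sq (hlam j).le]
    ring
  set W : ℕ → EuclideanSpace ℝ (Fin 3) → EuclideanSpace ℝ (Fin 3) :=
    fun j y => physWindowField T (x (j + j₀)) (u (j + j₀)) (t (j + j₀)) y with hWdef
  have hW : ∀ (j : ℕ) (y : EuclideanSpace ℝ (Fin 3)), W j y =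
      (σ * ν) • ((lam (j + j₀) / ν) • u (j + j₀) (T + lam (j + j₀) ^ 2 * s / ν) (x (j + j₀) + lam (j + j₀) • (σ • y))) := by
    intro j y
    simp only [hWdef, physWindowField, hsq (j + j₀), smul_smul]
    rw [ht (j + j₀)]
    congr 1
    field_simp
  have hconvW : ∀ y, Tendsto (fun j => W j y) atTop (𝓝 (profileWindowField ν v s y)) := by
    intro y
    have h := ((hconv (σ • y)).comp hshift).const_smul (σ * ν)
    have h' : Tendsto (fun j => W j y) atTop (𝓝 ((σ * ν) • v s (σ • y))) := h.congr fun j => (hW j y).symm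
    simpa only [profileWindowField, hσ] using h'
  have hmem : ∀ j, t (j + j₀) ∈ Set.Ico 0 T := fun j =>
    ⟨(hj₀ (j + j₀) (Nat.le_add_left _ _)).1.le, (hj₀ (j + j₀) (Nat.le_add_left _ _)).2⟩
  have hWc : ∀ j, Continuous (W j) := fun j => by
    show Continuous fun y => physWindowField T (x (j + j₀)) (u (j + j₀)) (t (j + j₀)) y
    exact (((hcl (j + j₀)).contDiff_velocity (hmem j)).continuous.comp
      (continuous_const.add (continuous_const_smul _))).const_smul (Real.sqrt (T - t (j + j₀)))
  have hWfun : ∀ j, W j = physWindowField T (x (j + j₀)) (u (j + j₀)) (t (j + j₀)) := fun j => rfl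
  have hle : Φ (profileWindowField ν v s) ≤ liminf (fun j => Φ (W j)) atTop :=
    hlsc W (profileWindowField ν v s) hWc (continuous_profileWindowField hvs) hconvW
  have hsmallW : ∀ᶠ j in atTop, Φ (W j) ≤ ENNReal.ofReal ε := by
    filter_upwards [hsmallj] with j hj
    simpa only [hWfun] using hj
  exact hle.trans (liminf_le_of_frequently_le' hsmallW.frequently)

/-! ## §5 the class-uniform one-time door from I1⋆ and the one-slice residue / Liouville theorem -/

/-- **THE CLASS-UNIFORM ONE-TIME DOOR (generic logic, PROVED modulo I1⋆):** I1⋆ + (H1) + the one-slice residue at `D = M/ν`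
⇒ `UniformOneTimeDoorAt Φ ν M`.  Compactness over (solution, centre, time) triples of one class: if for every `t⋆ < T` some
solution of the class were singular at some `(x₀, T)` yet `Φ ≤ ε` at some time in `(t⋆, T)`, the triples with `t⋆ = T − 1/(n+1)`
zoom (I1⋆) to a Type-I(`M/ν`) profile with the floor and `Φ ≤ ε` on its slice window at profile time `−1` — excluded by the residue. -/
theorem uniformOneTimeDoorAt_of (h₁ : LocalPointZoomAcrossSolutionsM) (hlsc : IsWindowLsc Φ) {ν M : ℝ} (hν : 0 < ν)
    (h₂ : ∀ c : ℝ, 0 < c → 0 < M / ν → OneSliceResidue Φ ν (M / ν) c) : UniformOneTimeDoorAt Φ ν M := by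
  obtain ⟨c, hc, hzoom⟩ := h₁ ν hν M
  -- the excluding `ε`: degenerate decay constant ⇒ any `ε`; else the residue's
  have hε : ∃ ε : ℝ, 0 < ε ∧
      ∀ (v : ℝ → EuclideanSpace ℝ (Fin 3) → EuclideanSpace ℝ (Fin 3)) (q : ℝ → EuclideanSpace ℝ (Fin 3) → ℝ),
      IsClassicalNSSolutionOn (Set.Iio 0) 1 0 v q → HasTypeIDecay (M / ν) v → HasL3Floor c v →
      Φ (profileWindowField ν v (-1)) ≤ ENNReal.ofReal ε → False := by
    rcases le_or_gt (M / ν) 0 with hD | hD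
    · exact ⟨1, one_pos, fun v q _ hdecay hfloor _ =>
        not_hasL3Floor_of_eq_zero hc (eq_zero_of_decay_nonpos hD hdecay) hfloor⟩
    · exact h₂ c hc hD
  obtain ⟨ε, hε0, hres⟩ := hε
  refine ⟨ε, hε0, fun T ρ E₀ hT hρ => ?_⟩
  by_contra hno
  push Not at hno
  have hsel : ∀ n : ℕ, ∃ (u : ℝ → EuclideanSpace ℝ (Fin 3) → EuclideanSpace ℝ (Fin 3))
      (p : ℝ → EuclideanSpace ℝ (Fin 3) → ℝ),
      IsClassicalNSSolutionOn (Set.Ico 0 T) ν 0 u p ∧ IsLerayHopfOn T ν 0 (u 0) u ∧ HasRapidSpatialDecay (u 0) ∧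
      VectorCalculus.kineticEnergy (u 0) ≤ E₀ ∧ ∃ x₀ : EuclideanSpace ℝ (Fin 3),
      (∀ t ∈ Set.Ico 0 T, T - ρ ^ 2 < t → ∀ x ∈ Metric.ball x₀ ρ, ‖u t x‖ * (‖x - x₀‖ + Real.sqrt (ν * (T - t))) ≤ M) ∧
      ∃ tb ∈ Set.Ioo (T - 1 / ((n : ℝ) + 1)) T,
        Φ (physWindowField T x₀ u tb) ≤ ENNReal.ofReal ε ∧ ¬ IsBackwardBoundedAt u T x₀ := fun n =>
    hno _ (sub_inv_succ_lt T n)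
  choose u p hcl hLH hdec hE x₀ hM tb htb hΦ hnb using hsel
  have hlim : Tendsto tb atTop (𝓝 T) :=
    tendsto_of_tendsto_of_tendsto_of_le_of_le (tendsto_sub_inv_succ T) tendsto_const_nhds
      (fun n => (htb n).1.le) (fun n => (htb n).2.le)
  obtain ⟨φ, C, v, lam, hφ, hlam, hlam2, hcls, hdecay, hfloor, hconv⟩ :=
    hzoom T ρ E₀ hT hρ u p x₀ tb hcl hLH hdec hE hM hnb (fun n => (htb n).2) hlim
  have hlam0 : Tendsto lam atTop (𝓝 0) := tendsto_lam_zero hφ hlim hlam hlam2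
  obtain ⟨hrate, hcont, hmild, hdiv⟩ := hcls
  have hmildcls : IsTypeIAncientMild C v := isTypeIAncientMild_of_class hrate hcont hmild hdiv
  obtain ⟨q, hclv⟩ :=
    Summit.NavierStokesRegularity.NavierStokesRegularity.Theorems.exists_isClassicalNSSolutionOn_Iio_of_isTypeIAncientMild
      hmildcls
  have hm1 : (-1 : ℝ) < 0 := by norm_num
  have hm14 : (-1 : ℝ) < -(1 / 4 : ℝ) := by norm_num
  have htime : ∀ j, T + lam j ^ 2 * (-1) / ν = tb (φ j) := by
    intro j
    rw [hlam2 j]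
    field_simp
    ring
  have hsmall : ∀ᶠ j in atTop,
      Φ (physWindowField T (x₀ (φ j)) (u (φ j)) (T + lam j ^ 2 * (-1) / ν)) ≤ ENNReal.ofReal ε :=
    Eventually.of_forall fun j => by rw [htime j]; exact hΦ (φ j)
  have hwin : Φ (profileWindowField ν v (-1)) ≤ ENNReal.ofReal ε :=
    windowLimit_atSeq (u := fun j => u (φ j)) (p := fun j => p (φ j)) (x := fun j => x₀ (φ j)) hlsc hν hT
      (fun j => hcl (φ j)) hlam hlam0 (hconv (-1) hm14) hm1 (continuous_slice_of_continuousOn hcont hm1) hsmall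
  exact hres v q hclv hdecay hfloor hwin

/-- **The class-uniform one-time door with ONE analytic input per stratum:** I1⋆ + (H1) + (H2) + a one-slice stratum Liouville
theorem ⇒ `UniformOneTimeDoorAt Φ ν M` (I2a is the tree's `floorSurvives_holds`, the residue the tree's `oneSliceResidue_of`). -/
theorem uniformOneTimeDoorAt_of_liouville {ν M : ℝ} (hν : 0 < ν) (h₁ : LocalPointZoomAcrossSolutionsM) (hlsc : IsWindowLsc Φ)
    (hspread : SpreadsTo Φ 𝔖 ν) (hLiou : ∀ D : ℝ, 0 < D → OneSliceLiouville 𝔖 D) : UniformOneTimeDoorAt Φ ν M :=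
  uniformOneTimeDoorAt_of h₁ hlsc hν fun _ hc hD =>
    oneSliceResidue_of hD hlsc hspread (floorSurvives_holds hc) (hLiou (M / ν) hD)

/-- **Instance (PROVED modulo I1⋆): the class-uniform one-time QUIET door** — `Φ =` the null-stratum cap observable of
`StableStrataDoorOneSliceAxiSeq` is not imported here; we record the generic corollary at the null stratum through its
one-slice Liouville theorem as a hypothesis, to keep this sketch's imports minimal. -/
theorem uniformOneTimeDoorAt_of_liouville' {ν M : ℝ} (hν : 0 < ν) (h₁ : LocalPointZoomAcrossSolutionsM) (hlsc : IsWindowLsc Φ)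
    (hspread : SpreadsTo Φ 𝔖 ν) (hLiou : ∀ D : ℝ, 0 < D → OneSliceLiouville 𝔖 D) :
    UniformOneTimeDoorAt Φ ν M ∧ SeqDoorAt Φ ν M :=
  ⟨uniformOneTimeDoorAt_of_liouville hν h₁ hlsc hspread hLiou,
    seqDoorAt_of_uniform (uniformOneTimeDoorAt_of_liouville hν h₁ hlsc hspread hLiou)⟩

end Summit.NavierStokesRegularity.NavierStokesRegularity.Theorems.OneTimeDoorSchema

end
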